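import Summits.KontsevichZagierPeriods.Zeta5Search.WellPoisedFaceGrowth
import HarnessLib

/-!
# `ζ(5)` search — the INTERIOR of Zudilin's `ζ(5)`-only well-poised box, file 1 of 2: typed forms, Lemma 19's
normalisation, the crude integer side of (8.9) (cell `pub-zeta5`, class vwp, fam-vwp gen 62–63;
families/vwp/FAMILY.md §13, §28, §70–§71)

Zudilin 2004 §8 [Zudilin2004 = arXiv:math/0206176], `r = 3`, `q = 7`: directions `(η₀; η₁ ≤ ⋯ ≤ η₇)`,
`h₀ = η₀n + 2`, `h_j = η_j n + 1`, `2η₇ < η₀`.  Files 1–5 of the face chain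
(`WellPoisedFace{Envelope,BoundaryRate,Convexity,Sandwich,Growth}`) settle the NUMERATOR-FREE FACE `η₁ = η₂ = η₃ = 0`
inside the kernel: there `F(h_n) > 0` and the Lemma-19-normalised forms `Λ_n → +∞`.  This file and its sequel
`WellPoisedInteriorNoGo` treat the INTERIOR `η₁ ≥ 1`, where `F(h_n)` is a real oscillating quantity (two
complex-conjugate saddles) and no positivity is available.  What the kernel can hold is the REDUCTION of the interior
no-go to two analytic rate statements (the sequel), plus all the arithmetic bookkeeping (this file).

Contents (every statement kernel-checked, standard axioms; no `sorry`):
* §I1 the general very-well-poised summand `R(t)` of (8.5) with the three PAIR factors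
  `(t+1)_{h_j−1}(t+h₀−h_j+1)_{h_j−1}/((h_j−1)!)²`, `j = 1,2,3`, typed over directions
  `ηp : Fin 3 → ℕ` (pairs), `ηb : Fin 4 → ℕ` (bricks); `F(h) = ½ Σ_{t≥0} R''(t)` [(8.6); the pair zeros of order
  three at `t = −1, …, 1−h₁` make `Σ_{t ≥ 1−h₁}` equal to `Σ_{t ≥ 0}`]; DICTIONARY `genR η₀ 0 ηb = faceR η₀ ηb`,
  `genF η₀ 0 ηb = faceF η₀ ηb` (pairs switched off = the face of files 2–5).
* §I2 Lemma 19's normalisation VERBATIM at general parameters: `M_j = max{h₃−1, h₀−2h₄, h₀−h₁−h_{3+j}}` (file 1's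
  `mLast`), `Φ(h)` (file 1's `Phi`, (8.9) with the pair terms ON), `Λ_n := D_{M₁}³ D_{M₂} D_{M₃} D_{M₄} Φ⁻¹ F`;
  dictionary `M_j = n·m_j`, `m_j = max{η₃, η₀−2η₄, η₀−η₁−η_{3+j}}`, `δ = 3m₁+m₂+m₃+m₄`; `gen* η₀ 0 ηb = face*`.
* §I3 the integer side of (8.9) anywhere in the box: each pair term `≤ 2`, so `ν_p ≤ 9` and `Φ ≤ (M₄#)⁹`,
  `log Φ(h_n) ≤ 9θ(n m₄)` — recorded to document WHY the interior needs the sharp (Φ-rate)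
  `(1/n) log Φ(h_n) → ∫₀¹ φ dψ − ∫₀^{1/m₄} φ dx/x²` [Zudilin2004 §8, the display before Proposition 5]: `9m₄` exceeds
  `δ − C₀` at every interior direction of the certified table, whereas `φ` does not; three `decide`d kernel
  instances at the certified interior maximiser `(30; 1,1,1, 8,9,10,11)` (`δ = 120`).
HONEST FRAMING: systematic search; no irrationality claim unless certified.  Constants (`C₀`, `φ`, `δ`, `κ = C₀/(δ−φ)`)
are certified-MODEL, direction by direction, by the cell's compute lane (`run/shared/lean/ttrl/zeta5-calc/vwp/SUPKAPPA7.md`: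
exhaustive `8 ≤ η₀ ≤ 30`, `sup κ = 0.4171648 < 1` at `(30; 1,1,1, 8,9,10,11)`).
-/

noncomputable section

open Real Filter Topology Finset

namespace Summit.KontsevichZagierPeriods.Zeta5Search.WellPoisedInterior

open Summit.KontsevichZagierPeriods.Zeta5Search.WellPoisedFace
open Summit.KontsevichZagierPeriods.Zeta5Search.WellPoisedFaceRate
open Chebyshev

/-! ### §I1 The general summand with pairs, and `F = ½ Σ R''` -/

/-- The PAIR factor of slot `j ≤ r = 3` in (8.5): `(t+1)_{h_j−1} · (t+h₀−h_j+1)_{h_j−1} / ((h_j−1)!)²` with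
`h₀ = η₀n+2`, `h_j = e·n+1` (so `h_j − 1 = e n`, `h₀ − h_j + 1 = (η₀−e)n + 2`).  At `e = 0` it is `1`. -/
def pairFactor (η₀ e n : ℕ) (t : ℝ) : ℝ :=
  ((∏ i ∈ Finset.range (e * n), (t + 1 + (i : ℝ))) *
      ∏ i ∈ Finset.range (e * n), (t + (((η₀ - e) * n + 2 : ℕ) : ℝ) + (i : ℝ)))
    / ((((e * n).factorial : ℕ) : ℝ) ^ 2)

/-- Zudilin's very-well-poised summand `R(t)` of (8.5) for `r = 3`, `q = 7` at the direction
`(η₀; ηp 0, ηp 1, ηp 2, ηb 0, …, ηb 3)`: the three pair factors times the face summand of file 2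
(`faceR` = `(h₀+2t) · ∏_{j>3} Γ-blocks`). -/
def genR (η₀ : ℕ) (ηp : Fin 3 → ℕ) (ηb : Fin 4 → ℕ) (n : ℕ) (t : ℝ) : ℝ :=
  (∏ j : Fin 3, pairFactor η₀ (ηp j) n t) * faceR η₀ ηb n t

/-- `F(h_n) = ½ Σ_{t ≥ 0} R''(t)` [(8.6)] at a general direction (a real number; in the interior it changes sign
along subsequences — two conjugate saddles — which is why no positivity argument exists there). -/
def genF (η₀ : ℕ) (ηp : Fin 3 → ℕ) (ηb : Fin 4 → ℕ) (n : ℕ) : ℝ :=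
  (1 / 2 : ℝ) * ∑' t : ℕ, iteratedDeriv 2 (genR η₀ ηp ηb n) (t : ℝ)

/-- A pair factor with `η_j = 0` (`h_j = 1`) is identically `1`. -/
theorem pairFactor_zero (η₀ n : ℕ) : pairFactor η₀ 0 n = fun _ => 1 := by
  funext t
  simp [pairFactor]

/-- DICTIONARY: pairs switched off (`ηp = 0`) give back the face summand of file 2. -/
theorem genR_face (η₀ : ℕ) (ηb : Fin 4 → ℕ) (n : ℕ) : genR η₀ 0 ηb n = faceR η₀ ηb n := by
  funext t
  simp [genR, pairFactor_zero]

/-- DICTIONARY: `F` at `ηp = 0` is the face quantity `faceF` of file 2. -/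
theorem genF_face (η₀ : ℕ) (ηb : Fin 4 → ℕ) (n : ℕ) : genF η₀ 0 ηb n = faceF η₀ ηb n := by
  unfold genF faceF
  rw [genR_face]

/-! ### §I2 Lemma 19's normalisation at general parameters (file 1's `mLast`, `Phi` VERBATIM) -/

/-- `h_j = η_j n + 1` (`j = 1,2,3`, the pair parameters) as an integer. -/
def hpZ (ηp : Fin 3 → ℕ) (n : ℕ) (i : Fin 3) : ℤ := ((ηp i * n + 1 : ℕ) : ℤ)

/-- `M_j = max{h₃ − 1, h₀ − 2h₄, h₀ − h₁ − h_{3+j}}` [Zudilin2004, p. 20] VERBATIM (file 1's `mLast`, whose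
arguments are `h₀ h₁ h₃ h₄ h_{3+j}`). -/
def genMZ (η₀ : ℕ) (ηp : Fin 3 → ℕ) (ηb : Fin 4 → ℕ) (n : ℕ) (j : Fin 4) : ℤ :=
  mLast (h0Z η₀ n) (hpZ ηp n 0) (hpZ ηp n 2) (hZ ηb n 0) (hZ ηb n j)

/-- The unscaled exponent `m_j = max{η₃, η₀ − 2η₄, η₀ − η₁ − η_{3+j}}` (a natural number). -/
def genM (η₀ : ℕ) (ηp : Fin 3 → ℕ) (ηb : Fin 4 → ℕ) (j : Fin 4) : ℕ :=
  max (max (ηp 2) (η₀ - 2 * ηb 0)) (η₀ - ηp 0 - ηb j)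

/-- `δ = 3m₁ + m₂ + m₃ + m₄`: the exponential rate of `D_{M₁}³ D_{M₂} D_{M₃} D_{M₄}`. -/
def genDelta (η₀ : ℕ) (ηp : Fin 3 → ℕ) (ηb : Fin 4 → ℕ) : ℕ :=
  3 * genM η₀ ηp ηb 0 + genM η₀ ηp ηb 1 + genM η₀ ηp ηb 2 + genM η₀ ηp ηb 3

/-- Zudilin's `Φ(h_n)` of (8.9) with the pair terms present (file 1's `Phi`). -/
def genPhi (η₀ : ℕ) (ηp : Fin 3 → ℕ) (ηb : Fin 4 → ℕ) (n : ℕ) : ℕ :=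
  Phi (h0Z η₀ n) (hpZ ηp n 0) (hpZ ηp n 1) (hpZ ηp n 2) (hZ ηb n 0) (hZ ηb n 1) (hZ ηb n 2) (hZ ηb n 3)

/-- THE NORMALISED FORMS `Λ_n := D_{M₁}³ D_{M₂} D_{M₃} D_{M₄} · Φ(h_n)⁻¹ · F(h_n)` of Lemma 19 at a general
direction (`D_N = Nat.lcmUpto N`).  Lemma 19 says `Λ_n ∈ ℤζ(5) + ℤ` — PRINTED at general parameters (kernel on the
face: `WellPoisedFacePhi.faceLambda_mem`); not used in this file. -/
def genLambda (η₀ : ℕ) (ηp : Fin 3 → ℕ) (ηb : Fin 4 → ℕ) (n : ℕ) : ℝ :=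
  ((Nat.lcmUpto (genMZ η₀ ηp ηb n 0).toNat : ℝ) ^ 3 * Nat.lcmUpto (genMZ η₀ ηp ηb n 1).toNat
      * Nat.lcmUpto (genMZ η₀ ηp ηb n 2).toNat * Nat.lcmUpto (genMZ η₀ ηp ηb n 3).toNat)
    / (genPhi η₀ ηp ηb n : ℝ) * genF η₀ ηp ηb n

/-- `h_j = 1` for the pair slots when `ηp = 0`. -/
theorem hpZ_zero (n : ℕ) (i : Fin 3) : hpZ 0 n i = 1 := by
  simp [hpZ]

/-- DICTIONARY: `M_j` at `ηp = 0` is file 5's `faceMZ`. -/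
theorem genMZ_face (η₀ : ℕ) (ηb : Fin 4 → ℕ) (n : ℕ) (j : Fin 4) :
    genMZ η₀ 0 ηb n j = faceMZ η₀ ηb n j := by
  unfold genMZ faceMZ
  rw [hpZ_zero, hpZ_zero]

/-- DICTIONARY: `Φ` at `ηp = 0` is file 5's `facePhi`. -/
theorem genPhi_face (η₀ : ℕ) (ηb : Fin 4 → ℕ) (n : ℕ) : genPhi η₀ 0 ηb n = facePhi η₀ ηb n := by
  unfold genPhi facePhi
  rw [hpZ_zero, hpZ_zero, hpZ_zero]

/-- DICTIONARY: `Λ_n` at `ηp = 0` is file 5's `faceLambda`. -/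
theorem genLambda_face (η₀ : ℕ) (ηb : Fin 4 → ℕ) (n : ℕ) :
    genLambda η₀ 0 ηb n = faceLambda η₀ ηb n := by
  unfold genLambda faceLambda
  rw [genMZ_face, genMZ_face, genMZ_face, genMZ_face, genPhi_face, genF_face]

/-- DICTIONARY: `m_j` at `ηp = 0` is file 5's `faceM`. -/
theorem genM_face (η₀ : ℕ) (ηb : Fin 4 → ℕ) (j : Fin 4) : genM η₀ 0 ηb j = faceM η₀ ηb j := by
  simp [genM, faceM]

/-- DICTIONARY (kernel): `M_j = n · m_j` exactly, for every admissible direction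
(`η_i ≤ η₄` for the pairs, `2η_j < η₀` for the bricks). -/
theorem genMZ_eq (η₀ : ℕ) (ηp : Fin 3 → ℕ) (ηb : Fin 4 → ℕ) (hpb : ∀ i, ηp i ≤ ηb 0)
    (hb : ∀ j, 2 * ηb j < η₀) (n : ℕ) (j : Fin 4) :
    genMZ η₀ ηp ηb n j = ((n * genM η₀ ηp ηb j : ℕ) : ℤ) := by
  have h0 := hb 0
  have hj := hb j
  have hp0 := hpb 0
  have hle1 : 2 * ηb 0 ≤ η₀ := by omega
  have hle2 : ηp 0 ≤ η₀ := by omega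
  have hle3 : ηb j ≤ η₀ - ηp 0 := by omega
  have A : ((ηp 2 * n + 1 : ℕ) : ℤ) - 1 = (n : ℤ) * ((ηp 2 : ℕ) : ℤ) := by
    push_cast; ring
  have B : ((η₀ * n + 2 : ℕ) : ℤ) - 2 * ((ηb 0 * n + 1 : ℕ) : ℤ) = (n : ℤ) * ((η₀ - 2 * ηb 0 : ℕ) : ℤ) := by
    rw [Nat.cast_sub hle1]; push_cast; ring
  have C : ((η₀ * n + 2 : ℕ) : ℤ) - ((ηp 0 * n + 1 : ℕ) : ℤ) - ((ηb j * n + 1 : ℕ) : ℤ)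
      = (n : ℤ) * ((η₀ - ηp 0 - ηb j : ℕ) : ℤ) := by
    rw [Nat.cast_sub hle3, Nat.cast_sub hle2]; push_cast; ring
  unfold genMZ mLast h0Z hZ hpZ genM
  rw [A, B, C, Nat.cast_mul, Nat.cast_max, Nat.cast_max,
    mul_max_of_nonneg _ _ (by positivity : (0 : ℤ) ≤ n), mul_max_of_nonneg _ _ (by positivity : (0 : ℤ) ≤ n)]

/-- `M_j` as a natural number is `n · m_j`. -/
theorem genMZ_toNat (η₀ : ℕ) (ηp : Fin 3 → ℕ) (ηb : Fin 4 → ℕ) (hpb : ∀ i, ηp i ≤ ηb 0)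
    (hb : ∀ j, 2 * ηb j < η₀) (n : ℕ) (j : Fin 4) :
    (genMZ η₀ ηp ηb n j).toNat = n * genM η₀ ηp ηb j := by
  rw [genMZ_eq η₀ ηp ηb hpb hb n j, Int.toNat_natCast]

/-- `m_j ≥ 1` (indeed `m_j ≥ η₀ − 2η₄ ≥ 1`). -/
theorem genM_pos (η₀ : ℕ) (ηp : Fin 3 → ℕ) (ηb : Fin 4 → ℕ) (hb : ∀ j, 2 * ηb j < η₀) (j : Fin 4) :
    0 < genM η₀ ηp ηb j := by
  have h0 := hb 0
  have h1 := le_max_right (ηp 2) (η₀ - 2 * ηb 0)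
  have h2 := le_max_left (max (ηp 2) (η₀ - 2 * ηb 0)) (η₀ - ηp 0 - ηb j)
  unfold genM
  omega

/-- `Φ(h_n) ≥ 1 > 0` (a product of prime powers). -/
theorem genPhi_pos (η₀ : ℕ) (ηp : Fin 3 → ℕ) (ηb : Fin 4 → ℕ) (n : ℕ) : 0 < genPhi η₀ ηp ηb n := by
  unfold genPhi Phi
  exact Finset.prod_pos fun p hp => pow_pos (Finset.mem_filter.1 hp).2.pos _

/-- The `D`-product `D_{M₁}³ D_{M₂} D_{M₃} D_{M₄}` equals `exp(3ψ(M₁) + ψ(M₂) + ψ(M₃) + ψ(M₄))` (`D_N = e^{ψ(N)}`). -/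
theorem lcmProd_eq_exp (a b c d : ℕ) :
    ((Nat.lcmUpto a : ℝ) ^ 3 * Nat.lcmUpto b * Nat.lcmUpto c * Nat.lcmUpto d)
      = Real.exp (3 * ψ (a : ℝ) + ψ (b : ℝ) + ψ (c : ℝ) + ψ (d : ℝ)) := by
  have hL : ∀ N : ℕ, (0 : ℝ) < (Nat.lcmUpto N : ℝ) := fun N => by exact_mod_cast Nat.lcmUpto_pos N
  have hE : ∀ N : ℕ, (Nat.lcmUpto N : ℝ) = Real.exp (ψ (N : ℝ)) := fun N => by
    rw [psi_eq_log_lcmUpto N, Real.exp_log (hL N)]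
  rw [hE a, hE b, hE c, hE d, ← Real.exp_nat_mul, ← Real.exp_add, ← Real.exp_add, ← Real.exp_add]
  push_cast
  ring_nf

/-- `|Λ_n| = exp(3ψ(nm₁) + ψ(nm₂) + ψ(nm₃) + ψ(nm₄)) / Φ(h_n) · |F(h_n)|`. -/
theorem abs_genLambda_eq (η₀ : ℕ) (ηp : Fin 3 → ℕ) (ηb : Fin 4 → ℕ) (hpb : ∀ i, ηp i ≤ ηb 0)
    (hb : ∀ j, 2 * ηb j < η₀) (n : ℕ) :
    |genLambda η₀ ηp ηb n|
      = Real.exp (3 * ψ ((n * genM η₀ ηp ηb 0 : ℕ) : ℝ) + ψ ((n * genM η₀ ηp ηb 1 : ℕ) : ℝ)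
          + ψ ((n * genM η₀ ηp ηb 2 : ℕ) : ℝ) + ψ ((n * genM η₀ ηp ηb 3 : ℕ) : ℝ))
        / (genPhi η₀ ηp ηb n : ℝ) * |genF η₀ ηp ηb n| := by
  have hΦ : (0 : ℝ) < genPhi η₀ ηp ηb n := by exact_mod_cast genPhi_pos η₀ ηp ηb n
  unfold genLambda
  rw [genMZ_toNat η₀ ηp ηb hpb hb n 0, genMZ_toNat η₀ ηp ηb hpb hb n 1, genMZ_toNat η₀ ηp ηb hpb hb n 2,
    genMZ_toNat η₀ ηp ηb hpb hb n 3, lcmProd_eq_exp, abs_mul, abs_div, abs_of_pos (Real.exp_pos _),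
    abs_of_pos hΦ]

/-! ### §I3 The integer side of (8.9) anywhere in the box: `ν_p ≤ 9`, `Φ ≤ (M₄#)⁹` (crude; documents the gap) -/

/-- Each pair summand of (8.9) is `≤ 2` (two floor carries). -/
theorem pairTerm_le_two (h0 hj k : ℤ) {p : ℤ} (hp : 0 < p) : pairTerm h0 hj k p ≤ 2 := by
  have h1 := (ediv_add_carry (k - hj) (hj - 1) hp).2
  have h2 := (ediv_add_carry (h0 - hj - k) (hj - 1) hp).2
  have e1 : k - hj + (hj - 1) = k - 1 := by ring
  have e2 : h0 - hj - k + (hj - 1) = h0 - k - 1 := by ring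
  rw [e1] at h1
  rw [e2] at h2
  unfold pairTerm
  linarith

/-- `ν_{h₄,p} ≤ 9` at every parameter set (`3` pairs `≤ 2` each, the slot-4 brick `= 0` at `k = h₄`, `3` bricks `≤ 1`). -/
theorem nuKP_at_h4_le_nine (h0 h1 h2 h3 h4 h5 h6 h7 : ℤ) {p : ℤ} (hp : 0 < p) :
    nuKP h0 h1 h2 h3 h4 h5 h6 h7 h4 p ≤ 9 := by
  have a1 := pairTerm_le_two h0 h1 h4 hp
  have a2 := pairTerm_le_two h0 h2 h4 hp
  have a3 := pairTerm_le_two h0 h3 h4 hp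
  have b5 := brickTerm_le_one h0 h5 h4 hp
  have b6 := brickTerm_le_one h0 h6 h4 hp
  have b7 := brickTerm_le_one h0 h7 h4 hp
  simp only [nuKP, brickTerm_self]
  linarith

/-- `ν_p ≤ 9` for every `p > 0` whenever the range `h₄ ≤ k ≤ h₀ − h₄` of (8.9) is non-empty. -/
theorem nuP_le_nine (h0 h1 h2 h3 h4 h5 h6 h7 : ℤ) {p : ℤ} (hp : 0 < p) (h : h4 ≤ h0 - h4) :
    nuP h0 h1 h2 h3 h4 h5 h6 h7 p ≤ 9 := by
  rw [nuP, dif_pos h]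
  exact (Finset.inf'_le _ (Finset.mem_Icc.2 ⟨le_rfl, h⟩)).trans (nuKP_at_h4_le_nine h0 h1 h2 h3 h4 h5 h6 h7 hp)

/-- `Φ ≤ (M₄#)⁹` anywhere in the box (crude: the true exponent rate (Φ-rate) is far smaller). -/
theorem Phi_le_primorial_pow_nine (h0 h1 h2 h3 h4 h5 h6 h7 : ℤ) (h : h4 ≤ h0 - h4) :
    Phi h0 h1 h2 h3 h4 h5 h6 h7 ≤ (primorial (mLast h0 h1 h3 h4 h7).toNat) ^ 9 := by
  unfold Phi
  set m := (mLast h0 h1 h3 h4 h7).toNat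
  set S := (Finset.Ioc (Nat.sqrt h0.toNat) m).filter Nat.Prime with hS
  calc ∏ p ∈ S, p ^ (nuP h0 h1 h2 h3 h4 h5 h6 h7 p).toNat ≤ ∏ p ∈ S, p ^ 9 := by
        apply Finset.prod_le_prod'
        intro p hp
        have hp' : p.Prime := (Finset.mem_filter.1 hp).2
        apply Nat.pow_le_pow_right hp'.pos
        exact Int.toNat_le.2 (nuP_le_nine h0 h1 h2 h3 h4 h5 h6 h7 (by exact_mod_cast hp'.pos) h)
    _ = (∏ p ∈ S, p) ^ 9 := Finset.prod_pow S 9 fun p => p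
    _ ≤ (primorial m) ^ 9 := by
        apply Nat.pow_le_pow_left
        unfold primorial
        apply Finset.prod_le_prod_of_subset_of_one_le'
        · intro p hp
          rw [hS, Finset.mem_filter, Finset.mem_Ioc] at hp
          exact Finset.mem_filter.2 ⟨Finset.mem_range.2 (Nat.lt_succ_of_le hp.1.2), hp.2⟩
        · intro p hp _
          exact (Finset.mem_filter.1 hp).2.one_lt.le

/-- `log Φ(h_n) ≤ 9·θ(n m₄)` at every admissible direction (kernel, crude). -/
theorem log_genPhi_le (η₀ : ℕ) (ηp : Fin 3 → ℕ) (ηb : Fin 4 → ℕ) (hpb : ∀ i, ηp i ≤ ηb 0)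
    (hb : ∀ j, 2 * ηb j < η₀) (n : ℕ) :
    Real.log (genPhi η₀ ηp ηb n) ≤ 9 * θ ((n * genM η₀ ηp ηb 3 : ℕ) : ℝ) := by
  have h0 := hb 0
  have hA : 2 * (ηb 0 * n) ≤ η₀ * n := by nlinarith
  have hrange : hZ ηb n 0 ≤ h0Z η₀ n - hZ ηb n 0 := by
    unfold hZ h0Z; push_cast; nlinarith
  have hle := Phi_le_primorial_pow_nine (h0Z η₀ n) (hpZ ηp n 0) (hpZ ηp n 1) (hpZ ηp n 2) (hZ ηb n 0)
    (hZ ηb n 1) (hZ ηb n 2) (hZ ηb n 3) hrange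
  have hM : (mLast (h0Z η₀ n) (hpZ ηp n 0) (hpZ ηp n 2) (hZ ηb n 0) (hZ ηb n 3)).toNat
      = n * genM η₀ ηp ηb 3 := genMZ_toNat η₀ ηp ηb hpb hb n 3
  rw [hM] at hle
  have hpos : (0 : ℝ) < genPhi η₀ ηp ηb n := by exact_mod_cast genPhi_pos η₀ ηp ηb n
  have hle' : (genPhi η₀ ηp ηb n : ℝ) ≤ ((primorial (n * genM η₀ ηp ηb 3) : ℕ) : ℝ) ^ 9 := by
    unfold genPhi; exact_mod_cast hle
  calc Real.log (genPhi η₀ ηp ηb n) ≤ Real.log (((primorial (n * genM η₀ ηp ηb 3) : ℕ) : ℝ) ^ 9) :=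
        Real.log_le_log hpos hle'
    _ = 9 * θ ((n * genM η₀ ηp ηb 3 : ℕ) : ℝ) := by
        rw [Real.log_pow, theta_eq_log_primorial, Nat.floor_natCast]
        push_cast; ring

/-- The crude kernel `Φ`-rate: for every `ε > 0`, eventually `Φ(h_n) ≤ exp((9m₄ + ε)·n)` (PNT for `θ`).  This
discharges hypothesis `hphi` of `interior_noGo_of_rates` with `φ⁺ = 9m₄ + ε` — never small enough in the
interior (certified table: `9m₄ > δ − C₀` there); the usable `φ⁺` is the (Φ-rate) [PRINTED]. -/
theorem genPhi_eventually_le (η₀ : ℕ) (ηp : Fin 3 → ℕ) (ηb : Fin 4 → ℕ) (hpb : ∀ i, ηp i ≤ ηb 0)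
    (hb : ∀ j, 2 * ηb j < η₀) (ε : ℝ) (hε : 0 < ε) :
    ∀ᶠ n : ℕ in atTop, (genPhi η₀ ηp ηb n : ℝ) ≤ Real.exp ((9 * (genM η₀ ηp ηb 3 : ℝ) + ε) * n) := by
  have ht := (tendsto_theta_mul_div (genM_pos η₀ ηp ηb hb 3)).const_mul 9
  have hev := ht.eventually (Iio_mem_nhds (show 9 * (genM η₀ ηp ηb 3 : ℝ) < 9 * genM η₀ ηp ηb 3 + ε by
    linarith))
  filter_upwards [hev, eventually_ge_atTop 1] with n hn hn1
  have hnpos : (0 : ℝ) < n := by exact_mod_cast hn1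
  have hpos : (0 : ℝ) < genPhi η₀ ηp ηb n := by exact_mod_cast genPhi_pos η₀ ηp ηb n
  have h1 := log_genPhi_le η₀ ηp ηb hpb hb n
  have h2 : 9 * θ ((n * genM η₀ ηp ηb 3 : ℕ) : ℝ) / n < 9 * (genM η₀ ηp ηb 3 : ℝ) + ε := by
    rwa [mul_div_assoc]
  rw [div_lt_iff₀ hnpos] at h2
  calc (genPhi η₀ ηp ηb n : ℝ) = Real.exp (Real.log (genPhi η₀ ηp ηb n)) := (Real.exp_log hpos).symm
    _ ≤ Real.exp ((9 * (genM η₀ ηp ηb 3 : ℝ) + ε) * n) := Real.exp_le_exp.2 (by linarith)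

/-- KERNEL INSTANCE of §I3 at the certified interior maximiser `(30; 1,1,1, 8,9,10,11)`, `n = 3`
(`h = (92; 4,4,4, 25,28,31,34)`), `p = 11`: every pair term at `k = h₄` equals `2` (the bound `pairTerm_le_two`
is attained) … -/
example : pairTerm 92 4 25 11 = 2 := by decide

/-- … and `ν_{h₄,11} = 7 > 3`: in the interior the `k = h₄` column of (8.9) exceeds the face bound `ν_p ≤ 3`
(the minimum over `k` is `ν_11 = 1` here; the sharp rate of `Φ` is the (Φ-rate), not a column bound). -/
example : nuKP 92 4 4 4 25 28 31 34 25 11 = 7 := by decide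

/-- KERNEL INSTANCE of the dictionary at the certified interior maximiser `(30; 1,1,1, 8,9,10,11)`:
`m_j = max{η₃, η₀−2η₄, η₀−η₁−η_{3+j}} = max{1, 14, 29−η_{3+j}} = (21, 20, 19, 18)`, `δ = 3·21+20+19+18 = 120`
(the certified table's `δ = 120` at this direction, SUPKAPPA7.md §1). -/
example : genDelta 30 ![1, 1, 1] ![8, 9, 10, 11] = 120 := by decide

end Summit.KontsevichZagierPeriods.Zeta5Search.WellPoisedInterior
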